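/-
Origin: expansion seat `planner-pub-hodgecm-pv02-g3-0`, handover #7 2026-08-18T06:10:43Z (`HOME/pub-hodgecm-pv02-g3/lean/Pv02g3/PerL34/SplitHolForms.lean`, md5 34f001f1, 227 lines);
landed by the gen-6 packager in gate run 24 as `HodgeCM/PerL34/SplitHolForms.lean` (import ^import Pv[0-9]+g[0-9]+\.PerL34\.→import HodgeCM.PerL34. ×1; stripped 2 #print/#check/#eval lines).
-/
/-
Origin: planner-pub-hodgecm-pv02-g3-0 (unit pub-hodgecm-pv02-g3, DAG-NODE PROVER #02 gen 3), 2026-08-18.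
Proposed tree path: `HodgeCM/PerL34/SplitHolForms.lean` (new, additive).  Imports my `S1StrengthCR` (run-24 queue)
and the LANDED `HodgeCM.PerL34.BallCR` (through it).  KERNEL: nothing cited, nothing asserted.
-/
import Summits.HodgeConjecture.HodgeCM.PerL34.S1StrengthCR_2

/-!
# Towards the residual `SplitHolConfig`: the `U(2,1)`-orbit spans of `dz₀` and of `z₀dz₁ − z₁dz₀`

`S1StrengthCR` reduces referee A's strength question for the CR binder to a `T`-free statement about the unit
ball, `SplitHolConfig`: two non-zero, disjoint `ℂ`-subspaces of holomorphic one-forms on `𝔹²` whose frame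
readings are stable under all left translations of `U(2,1)`.  This file builds the natural candidate and proves
everything except disjointness:

* `push s u (x) := ᵗJac(s,x) · u(s·x)` — the pullback `s^*u` of a one-form; `R (push s u) = lTransl s (R u)`
  (`lTransl_R`, from `BallCR.R_mul`), `push g (push s u) = push (s * g) u` (`push_push`, by injectivity of `R` —
  no chain rule needed), `push 1 u = u`;
* `push s` preserves holomorphy on the whole ball (`ballHol_push`: chain rule at every point, `BallDeriv`);
* `orbitSpan u₀ := span {push s u₀ : s ∈ U21}` is non-zero for `u₀ ≠ 0`, holomorphic for holomorphic `u₀`, and its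
  frame readings are `lTransl`-stable for EVERY `g ∈ U21` (`orbitSpan_stable`);
* `dz0 := dz₀` and `omega0 := z₀dz₁ − z₁dz₀` are holomorphic and non-zero.

Hence (`splitHolConfig_of_disjoint`) the residual is EXACTLY the disjointness
`orbitSpan dz0 ⊓ orbitSpan omega0 = ⊥` (`OrbitSpansDisjoint`), an elementary statement about rational one-forms
on `ℂ²` (both families consist of forms `((αz₁+β), (−αz₀+γ))/ℓ_s²`, `ℓ_s = p z₀ + q z₁ + r` the last row of `s`;
the functional `αr + pγ − qβ` vanishes on the first family and equals `−det s` on the generators of the second;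
what is missing is the partial-fraction uniqueness over the lines `ℓ_s = 0`).  It is recorded, not asserted.
-/

noncomputable section

open Complex Matrix

namespace HodgeCM
namespace PerL34
namespace SplitHolForms

open HodgeCM.PerL34.BallModel HodgeCM.PerL34.BallSpans HodgeCM.PerL34.BallFrame HodgeCM.PerL34.BallCR
  HodgeCM.PerL34.S1StrengthCR

/-! ## 1. The pullback of a one-form along `s ∈ U(2,1)` -/

/-- `push s u (x) = ᵗJac(s,x) · u(s·x)`: the pullback `s^*u` of the one-form `u`. -/
def push (s : U21) (u : Ball → (Fin 2 → ℂ)) : Ball → (Fin 2 → ℂ) := fun x => (Jac s x)ᵀ *ᵥ u (s • x)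

/-- (Ported verbatim from the HodgeCMPerL package; no docstring in the source.) -/
theorem push_apply (s : U21) (u : Ball → (Fin 2 → ℂ)) (x : Ball) : push s u x = (Jac s x)ᵀ *ᵥ u (s • x) := rfl

/-- The frame reading of `s^*u` is the left translate of the frame reading of `u`. -/
theorem R_push (s : U21) (u : Ball → (Fin 2 → ℂ)) (y : U21) : R (push s u) y = R u (s * y) := by
  rw [R_eq_transpose_Jac, R_mul, push_apply]

/-- (Ported verbatim from the HodgeCMPerL package; no docstring in the source.) -/
theorem lTransl_R (s : U21) (u : Ball → (Fin 2 → ℂ)) : P43.lTransl s (R u) = R (push s u) := by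
  funext y
  rw [P43.lTransl_apply, R_push]

/-- `push s` as a linear map. -/
def pushₗ (s : U21) : (Ball → (Fin 2 → ℂ)) →ₗ[ℂ] (Ball → (Fin 2 → ℂ)) where
  toFun := push s
  map_add' u u' := by funext x; simp [push_apply, Matrix.mulVec_add]
  map_smul' c u := by funext x; simp [push_apply, Matrix.mulVec_smul]

/-- (Ported verbatim from the HodgeCMPerL package; no docstring in the source.) -/
@[simp] theorem pushₗ_apply (s : U21) (u : Ball → (Fin 2 → ℂ)) : pushₗ s u = push s u := rfl

/-- `g^*(s^*u) = (s g)^*u` — from `R`'s injectivity. -/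
theorem push_push (g s : U21) (u : Ball → (Fin 2 → ℂ)) : push g (push s u) = push (s * g) u := by
  apply R_injective
  funext y
  rw [R_push, R_push, R_push, mul_assoc]

/-- (Ported verbatim from the HodgeCMPerL package; no docstring in the source.) -/
theorem push_one (u : Ball → (Fin 2 → ℂ)) : push 1 u = u := by
  apply R_injective
  funext y
  rw [R_push, one_mul]

/-! ## 2. `push s` preserves holomorphy on the whole ball -/

/-- (Ported verbatim from the HodgeCMPerL package; no docstring in the source.) -/
theorem isOpen_ballSet : IsOpen {y : Fin 2 → ℂ | nsq y < 1} := isOpen_lt continuous_nsq continuous_const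

/-- The coordinate pullback `pullVec s u` is `ℂ`-differentiable at every point of the ball if `u` is holomorphic. -/
theorem differentiableAt_pullVec_of_ballHol {u : Ball → (Fin 2 → ℂ)} (hu : ballHol u) (s : U21) (z : Ball) :
    DifferentiableAt ℂ (pullVec s u) z.1 := by
  have hA : DifferentiableAt ℂ (actVec s) z.1 := (hasFDerivAt_actVec s z).differentiableAt
  have hu' : DifferentiableAt ℂ (ext u) (actVec s z.1) := by rw [actVec_eq]; exact hu (s • z)
  have hE : DifferentiableAt ℂ (ext u ∘ actVec s) z.1 := hu'.comp z.1 hA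
  have hEj : ∀ j : Fin 2, DifferentiableAt ℂ (fun y => ext u (actVec s y) j) z.1 :=
    fun j => differentiableAt_pi.1 hE j
  have hJ : ∀ j i : Fin 2, DifferentiableAt ℂ (fun y => JacVec s y j i) z.1 :=
    fun j i => differentiableAt_JacVec s z j i
  refine differentiableAt_pi.2 fun i => ?_
  have hfun : (fun y => pullVec s u y i) =
      fun y => JacVec s y 0 i * ext u (actVec s y) 0 + JacVec s y 1 i * ext u (actVec s y) 1 :=
    funext fun y => pullVec_apply s u y i
  rw [hfun]
  exact ((hJ 0 i).fun_mul (hEj 0)).fun_add ((hJ 1 i).fun_mul (hEj 1))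

/-- Near a point of the (open) ball, `ext (push s u)` IS `pullVec s u`. -/
theorem pullVec_eventuallyEq_ext_push (s : U21) (u : Ball → (Fin 2 → ℂ)) (z : Ball) :
    pullVec s u =ᶠ[nhds z.1] ext (push s u) := by
  filter_upwards [isOpen_ballSet.mem_nhds z.2] with y hy
  show pullVec s u (⟨y, hy⟩ : Ball).1 = ext (push s u) (⟨y, hy⟩ : Ball).1
  rw [pullVec_val, ext_val, push_apply]

/-- (Ported verbatim from the HodgeCMPerL package; no docstring in the source.) -/
theorem ballHol_push {u : Ball → (Fin 2 → ℂ)} (hu : ballHol u) (s : U21) : ballHol (push s u) := fun z =>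
  (pullVec_eventuallyEq_ext_push s u z).differentiableAt_iff.mp (differentiableAt_pullVec_of_ballHol hu s z)

/-- (Ported verbatim from the HodgeCMPerL package; no docstring in the source.) -/
theorem push_mem_holForms {u : Ball → (Fin 2 → ℂ)} (hu : u ∈ holForms) (s : U21) : push s u ∈ holForms :=
  (mem_holForms _).2 (ballHol_push ((mem_holForms _).1 hu) s)

/-! ## 3. Orbit spans -/

/-- The `ℂ`-span of the `U(2,1)`-orbit `{s^*u₀}` of a one-form. -/
def orbitSpan (u₀ : Ball → (Fin 2 → ℂ)) : Submodule ℂ (Ball → (Fin 2 → ℂ)) :=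
  Submodule.span ℂ (Set.range fun s : U21 => push s u₀)

/-- (Ported verbatim from the HodgeCMPerL package; no docstring in the source.) -/
theorem push_mem_orbitSpan (u₀ : Ball → (Fin 2 → ℂ)) (s : U21) : push s u₀ ∈ orbitSpan u₀ :=
  Submodule.subset_span ⟨s, rfl⟩

/-- (Ported verbatim from the HodgeCMPerL package; no docstring in the source.) -/
theorem self_mem_orbitSpan (u₀ : Ball → (Fin 2 → ℂ)) : u₀ ∈ orbitSpan u₀ := by
  simpa only [push_one] using push_mem_orbitSpan u₀ 1

/-- (Ported verbatim from the HodgeCMPerL package; no docstring in the source.) -/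
theorem orbitSpan_ne_bot {u₀ : Ball → (Fin 2 → ℂ)} (h : u₀ ≠ 0) : orbitSpan u₀ ≠ ⊥ := fun hb =>
  h ((Submodule.mem_bot ℂ).1 (hb ▸ self_mem_orbitSpan u₀))

/-- (Ported verbatim from the HodgeCMPerL package; no docstring in the source.) -/
theorem orbitSpan_le_holForms {u₀ : Ball → (Fin 2 → ℂ)} (h : u₀ ∈ holForms) : orbitSpan u₀ ≤ holForms :=
  Submodule.span_le.2 (by rintro _ ⟨s, rfl⟩; exact push_mem_holForms h s)

/-- The orbit span is stable under every `push g`. -/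
theorem push_mem_orbitSpan_of_mem (g : U21) {u₀ v : Ball → (Fin 2 → ℂ)} (hv : v ∈ orbitSpan u₀) :
    push g v ∈ orbitSpan u₀ := by
  have hle : (orbitSpan u₀).map (pushₗ g) ≤ orbitSpan u₀ := by
    rw [orbitSpan, Submodule.map_span_le]
    rintro _ ⟨s, rfl⟩
    rw [pushₗ_apply, push_push]
    exact push_mem_orbitSpan u₀ (s * g)
  exact hle ⟨v, hv, rfl⟩

/-- **Stability**: the frame readings of an orbit span are stable under EVERY left translation of `U(2,1)`. -/
theorem orbitSpan_stable (u₀ : Ball → (Fin 2 → ℂ)) (g : U21) :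
    ∀ Φ ∈ (orbitSpan u₀).map R, P43.lTransl g Φ ∈ (orbitSpan u₀).map R := by
  rintro Φ ⟨v, hv, rfl⟩
  exact ⟨push g v, push_mem_orbitSpan_of_mem g hv, (lTransl_R g v).symm⟩

/-! ## 4. The two generating forms -/

/-- `dz₀`. -/
def dz0 : Ball → (Fin 2 → ℂ) := fun _ => ![1, 0]

/-- `ω₀ = z₀dz₁ − z₁dz₀`, i.e. the vector `(−z₁, z₀)`. -/
def omega0 : Ball → (Fin 2 → ℂ) := fun x => ![-(x.1 1), x.1 0]

/-- (Ported verbatim from the HodgeCMPerL package; no docstring in the source.) -/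
theorem ballHol_dz0 : ballHol dz0 := by
  intro z
  have h : (fun _ : Fin 2 → ℂ => (![1, 0] : Fin 2 → ℂ)) =ᶠ[nhds z.1] ext dz0 := by
    filter_upwards [isOpen_ballSet.mem_nhds z.2] with y hy
    show _ = ext dz0 (⟨y, hy⟩ : Ball).1
    rw [ext_val]
    rfl
  exact h.differentiableAt_iff.mp (differentiableAt_const _)

/-- (Ported verbatim from the HodgeCMPerL package; no docstring in the source.) -/
theorem differentiableAt_omegaVec (y₀ : Fin 2 → ℂ) :
    DifferentiableAt ℂ (fun y : Fin 2 → ℂ => (![-(y 1), y 0] : Fin 2 → ℂ)) y₀ := by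
  refine differentiableAt_pi.2 fun i => ?_
  fin_cases i
  · simpa using (differentiableAt_apply (𝕜 := ℂ) (1 : Fin 2) y₀).neg
  · simpa using differentiableAt_apply (𝕜 := ℂ) (0 : Fin 2) y₀

/-- (Ported verbatim from the HodgeCMPerL package; no docstring in the source.) -/
theorem ballHol_omega0 : ballHol omega0 := by
  intro z
  have h : (fun y : Fin 2 → ℂ => (![-(y 1), y 0] : Fin 2 → ℂ)) =ᶠ[nhds z.1] ext omega0 := by
    filter_upwards [isOpen_ballSet.mem_nhds z.2] with y hy
    show _ = ext omega0 (⟨y, hy⟩ : Ball).1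
    rw [ext_val]
    rfl
  exact h.differentiableAt_iff.mp (differentiableAt_omegaVec z.1)

/-- (Ported verbatim from the HodgeCMPerL package; no docstring in the source.) -/
theorem dz0_ne_zero : dz0 ≠ 0 := by
  intro h
  have := congrFun (congrFun h x₀) 0
  simp [dz0] at this

/-- The point `(1/2, 0)` of the ball. -/
def xHalf : Ball := ⟨![(1 / 2 : ℂ), 0], by norm_num [nsq]⟩

/-- (Ported verbatim from the HodgeCMPerL package; no docstring in the source.) -/
theorem omega0_ne_zero : omega0 ≠ 0 := by
  intro h
  have := congrFun (congrFun h xHalf) 1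
  simp [omega0, xHalf] at this

/-! ## 5. The residual, reduced to one disjointness statement -/

/-- **The residual in final form**: the orbit spans of `dz₀` and of `z₀dz₁ − z₁dz₀` meet in `0`. -/
def OrbitSpansDisjoint : Prop := orbitSpan dz0 ⊓ orbitSpan omega0 = ⊥

/-- A `SplitHolConfig` from the two orbit spans, GIVEN their disjointness. -/
def splitHolConfig_of_disjoint (h : OrbitSpansDisjoint) : SplitHolConfig where
  𝒱 := ![orbitSpan dz0, orbitSpan omega0]
  hol i := by
    fin_cases i
    · exact orbitSpan_le_holForms ((mem_holForms _).2 ballHol_dz0)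
    · exact orbitSpan_le_holForms ((mem_holForms _).2 ballHol_omega0)
  ne_bot i := by
    fin_cases i
    · exact orbitSpan_ne_bot dz0_ne_zero
    · exact orbitSpan_ne_bot omega0_ne_zero
  inf_eq_bot := h
  stable i g := by
    fin_cases i
    · exact orbitSpan_stable dz0 g
    · exact orbitSpan_stable omega0 g

variable {U : Universe} (T : U.ThetaModel)

/-- **P1, S1 half, CR binder — residual named**: given ONLY the disjointness of the two orbit spans (a statement
about rational one-forms on `ℂ²`) and node N31, the CR binder is hereditary A6 plus non-empty character sets. -/
theorem weilStepsInputCR_iff_of_disjoint (h : OrbitSpansDisjoint) (hch : T.Open_chars) :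
    CharSpansCR.WeilStepsInputCR T ↔ StepsVacuity.Open_thetaWedgeHereditary T ∧ CharsNonempty T :=
  weilStepsInputCR_iff T (splitHolConfig_of_disjoint h) hch

end SplitHolForms
end PerL34
end HodgeCM

end

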